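import Literature.Analysis.Hypoelliptic.SchwartzAdjoint
import Literature.Analysis.Hypoelliptic.SymFields
import Literature.Analysis.Hypoelliptic.KohnWords
import Mathlib.Analysis.Calculus.FDeriv.Symmetric
import HarnessLib

/-!
# The flat calculus: coordinate vector fields, their brackets, and the symbolic dictionary

Analysis/Hypoelliptic support file serving the discharge of
`Literature.Analysis.Distribution.Hormander1967_thm11` (the link between Hörmander's bracket
condition on the `x`-side and the Fourier-side bracket words of Kohn's iteration).

Fix a frame `e : Fin n → V`. A coordinate field is a family `a : Fin n → V → ℂ` of smooth
coefficient functions (`X = ∑_l a_l ∂_{e_l}`).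

* `pd e l g = ∂_{e_l} g`; `XdC e a h = ∑ a_l ∂_l h` (the derivation), `divC e a = ∑ ∂_l a_l`,
  `flatC e a h = ∑_l ∂_l (a_l h) = X h + (div X) h` (minus the formal transpose), and the
  coordinate bracket `brC e a b` (`[X, Y]_m = X b_m - Y a_m`).
* **`[X♭, Y♭] = [X, Y]♭`** (`flatC_comm`): `X♭ (Y♭ h) - Y♭ (X♭ h) = [X,Y]♭ h` (symmetry of second
  derivatives).
* `CoefFam`: coefficient families `c_l + a_l` (`c_l` real constants, `a_l` real Schwartz
  functions), their Fourier-side encoding `CoefFam.enc` as a `Field V` with coefficients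
  `cmul c_l + conv θ_{a_l}`, and **`dx (toSym enc) = flatC`** (`CoefFam.dx_toSym_enc`).
* Bracket words: `x`-side iterated brackets `Fw`, symbolic iterated commutators `Cw`, signs
  `sgn`, and **`dx (Cw w) h = sgn w · (Fw w)♭ h`** (`dx_Cw`).

## References

* L. Hörmander, *The Analysis of Linear Partial Differential Operators I*, §7.1 (folklore).
-/

noncomputable section

open MeasureTheory Set Filter Function SchwartzMap
open scoped ENNReal NNReal Topology ComplexConjugate InnerProductSpace FourierTransform BigOperators
  ContDiff

namespace Literature.Analysis.Hypoelliptic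

variable {V : Type*} [NormedAddCommGroup V] [InnerProductSpace ℝ V]
variable {n : ℕ} (e : Fin n → V)

/-! ### Partial derivatives along the frame -/

/-- `∂_{e_l} g`. [folklore] -/
def pd (l : Fin n) (g : V → ℂ) : V → ℂ := fun y => fderiv ℝ g y (e l)

variable {e}


/-- (structural lemma) [folklore] -/
theorem pd_apply (l : Fin n) (g : V → ℂ) (y : V) : pd e l g y = fderiv ℝ g y (e l) := rfl

section Calculus

/-- Smoothness of `∂_l g`. [folklore] -/
theorem contDiff_pd (l : Fin n) {g : V → ℂ} (hg : ContDiff ℝ ∞ g) : ContDiff ℝ ∞ (pd e l g) := by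
  show ContDiff ℝ ∞ (fun y => fderiv ℝ g y (e l))
  exact (hg.fderiv_right (m := ∞) (mod_cast le_top)).clm_apply contDiff_const

/-- Additivity. [folklore] -/
theorem pd_add (l : Fin n) {f g : V → ℂ} (hf : ContDiff ℝ ∞ f) (hg : ContDiff ℝ ∞ g) (y : V) :
    pd e l (fun z => f z + g z) y = pd e l f y + pd e l g y := by
  simp only [pd]
  rw [fderiv_fun_add (hf.differentiable (by simp)).differentiableAt (hg.differentiable (by simp)).differentiableAt]
  rfl

/-- Subtraction. [folklore] -/
theorem pd_sub (l : Fin n) {f g : V → ℂ} (hf : ContDiff ℝ ∞ f) (hg : ContDiff ℝ ∞ g) (y : V) :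
    pd e l (fun z => f z - g z) y = pd e l f y - pd e l g y := by
  simp only [pd]
  rw [fderiv_fun_sub (hf.differentiable (by simp)).differentiableAt (hg.differentiable (by simp)).differentiableAt]
  rfl

/-- Constants. [folklore] -/
theorem pd_const_mul (l : Fin n) (c : ℂ) {g : V → ℂ} (hg : ContDiff ℝ ∞ g) (y : V) :
    pd e l (fun z => c * g z) y = c * pd e l g y := by
  simp only [pd]
  rw [fderiv_const_mul (hg.differentiable (by simp)).differentiableAt]
  simp

/-- The product rule. [folklore] -/
theorem pd_mul (l : Fin n) {f g : V → ℂ} (hf : ContDiff ℝ ∞ f) (hg : ContDiff ℝ ∞ g) (y : V) :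
    pd e l (fun z => f z * g z) y = f y * pd e l g y + pd e l f y * g y := by
  simp only [pd]
  rw [fderiv_fun_mul (hf.differentiable (by simp)).differentiableAt (hg.differentiable (by simp)).differentiableAt]
  simp only [_root_.add_apply, FunLike.coe_smul, Pi.smul_apply, smul_eq_mul]
  ring

/-- Finite sums. [folklore] -/
theorem pd_sum (l : Fin n) {ι : Type*} (S : Finset ι) {f : ι → V → ℂ} (hf : ∀ i, ContDiff ℝ ∞ (f i)) (y : V) :
    pd e l (fun z => ∑ i ∈ S, f i z) y = ∑ i ∈ S, pd e l (f i) y := by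
  simp only [pd]
  rw [fderiv_fun_sum fun i _ => ((hf i).differentiable (by simp)).differentiableAt]
  simp

/-- **Symmetry of second derivatives** along the frame. [folklore] -/
theorem pd_pd_comm (l m : Fin n) {g : V → ℂ} (hg : ContDiff ℝ ∞ g) (y : V) :
    pd e l (pd e m g) y = pd e m (pd e l g) y := by
  have hd : Differentiable ℝ (fderiv ℝ g) := (hg.fderiv_right (m := ∞) (mod_cast le_top)).differentiable (by simp)
  have key : ∀ l m : Fin n, pd e l (pd e m g) y = fderiv ℝ (fderiv ℝ g) y (e l) (e m) := by
    intro l m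
    show fderiv ℝ (fun y => fderiv ℝ g y (e m)) y (e l) = _
    rw [fderiv_clm_apply hd.differentiableAt (differentiableAt_const _)]
    simp
  rw [key, key]
  have h2 : minSmoothness ℝ 2 ≤ ((⊤ : ℕ∞) : WithTop ℕ∞) := by
    simp only [minSmoothness_of_isRCLikeNormedField]
    have h3 : ((2 : ℕ∞) : WithTop ℕ∞) ≤ ((⊤ : ℕ∞) : WithTop ℕ∞) := mod_cast le_top
    simpa using h3
  exact ((hg.contDiffAt (x := y)).isSymmSndFDerivAt h2) (e l) (e m)

end Calculus

/-! ### Coordinate fields: derivation, divergence, flat operator, bracket -/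

/-- `X h = ∑_l a_l ∂_l h`. [folklore] -/
def XdC (e : Fin n → V) (a : Fin n → V → ℂ) (h : V → ℂ) : V → ℂ := fun y => ∑ l, a l y * pd e l h y

/-- `div X = ∑_l ∂_l a_l`. [folklore] -/
def divC (e : Fin n → V) (a : Fin n → V → ℂ) : V → ℂ := fun y => ∑ l, pd e l (a l) y

/-- `X♭ h = ∑_l ∂_l (a_l h)` (minus the formal transpose). [folklore] -/
def flatC (e : Fin n → V) (a : Fin n → V → ℂ) (h : V → ℂ) : V → ℂ :=
  fun y => ∑ l, pd e l (fun z => a l z * h z) y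

/-- The coordinate bracket `[X, Y]_m = X b_m - Y a_m`. [folklore] -/
def brC (e : Fin n → V) (a b : Fin n → V → ℂ) : Fin n → V → ℂ :=
  fun m y => XdC e a (b m) y - XdC e b (a m) y

/-- Smooth families. [folklore] -/
def SmoothFam (a : Fin n → V → ℂ) : Prop := ∀ l, ContDiff ℝ ∞ (a l)

section FieldCalculus

variable {a b : Fin n → V → ℂ} {h : V → ℂ}

/-- Smoothness of `X h`. [folklore] -/
theorem SmoothFam.contDiff_XdC (ha : SmoothFam a) (hh : ContDiff ℝ ∞ h) : ContDiff ℝ ∞ (XdC e a h) := by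
  unfold XdC
  exact ContDiff.sum fun l _ => (ha l).mul (contDiff_pd l hh)

/-- Smoothness of `div X`. [folklore] -/
theorem SmoothFam.contDiff_divC (ha : SmoothFam a) : ContDiff ℝ ∞ (divC e a) := by
  unfold divC
  exact ContDiff.sum fun l _ => contDiff_pd l (ha l)

/-- Smoothness of `X♭ h`. [folklore] -/
theorem SmoothFam.contDiff_flatC (ha : SmoothFam a) (hh : ContDiff ℝ ∞ h) : ContDiff ℝ ∞ (flatC e a h) := by
  unfold flatC
  exact ContDiff.sum fun l _ => contDiff_pd l ((ha l).mul hh)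

/-- Smoothness of brackets. [folklore] -/
theorem SmoothFam.bracket (ha : SmoothFam a) (hb : SmoothFam b) : SmoothFam (brC e a b) := fun m =>
  (ha.contDiff_XdC (hb m)).sub (hb.contDiff_XdC (ha m))

/-- **`X♭ h = X h + (div X) h`.** [folklore] -/
theorem SmoothFam.flatC_eq (ha : SmoothFam a) (hh : ContDiff ℝ ∞ h) (y : V) :
    flatC e a h y = XdC e a h y + divC e a y * h y := by
  simp only [flatC, XdC, divC, Finset.sum_mul, ← Finset.sum_add_distrib]
  refine Finset.sum_congr rfl fun l _ => ?_
  rw [pd_mul l (ha l) hh]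

/-- Leibniz for the derivation: `X (m h) = (X m) h + m X h`. [folklore] -/
theorem XdC_mul {m : V → ℂ} (hm : ContDiff ℝ ∞ m) (hh : ContDiff ℝ ∞ h) (y : V) :
    XdC e a (fun z => m z * h z) y = XdC e a m y * h y + m y * XdC e a h y := by
  simp only [XdC, Finset.sum_mul, Finset.mul_sum, ← Finset.sum_add_distrib]
  refine Finset.sum_congr rfl fun l _ => ?_
  rw [pd_mul l hm hh]; ring

/-- Additivity of the derivation in `h`. [folklore] -/
theorem XdC_add {f g : V → ℂ} (hf : ContDiff ℝ ∞ f) (hg : ContDiff ℝ ∞ g) (y : V) :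
    XdC e a (fun z => f z + g z) y = XdC e a f y + XdC e a g y := by
  simp only [XdC, ← Finset.sum_add_distrib]
  refine Finset.sum_congr rfl fun l _ => ?_
  rw [pd_add l hf hg]; ring

/-- The derivation on finite sums. [folklore] -/
theorem XdC_sum {ι : Type*} (S : Finset ι) {f : ι → V → ℂ} (hf : ∀ i, ContDiff ℝ ∞ (f i)) (y : V) :
    XdC e a (fun z => ∑ i ∈ S, f i z) y = ∑ i ∈ S, XdC e a (f i) y := by
  simp only [XdC]
  rw [Finset.sum_comm]
  refine Finset.sum_congr rfl fun l _ => ?_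
  rw [pd_sum l S hf, Finset.mul_sum]

/-- **The commutator of derivations is the derivation of the bracket.** [folklore] -/
theorem SmoothFam.comm_XdC (ha : SmoothFam a) (hb : SmoothFam b) (hh : ContDiff ℝ ∞ h) (y : V) :
    XdC e a (XdC e b h) y - XdC e b (XdC e a h) y = XdC e (brC e a b) h y := by
  -- expand `X (Y h) = ∑_{l,m} a_l (∂_l b_m ∂_m h + b_m ∂_l ∂_m h)`
  have hexp : ∀ {a b : Fin n → V → ℂ}, SmoothFam a → SmoothFam b →
      XdC e a (XdC e b h) y = ∑ l, ∑ m, (a l y * pd e l (b m) y * pd e m h y +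
        a l y * b m y * pd e l (pd e m h) y) := by
    intro a b _ hb
    simp only [XdC]
    refine Finset.sum_congr rfl fun l _ => ?_
    show a l y * pd e l (fun z => ∑ m ∈ Finset.univ, b m z * pd e m h z) y = _
    rw [pd_sum l Finset.univ (fun m => (hb m).mul (contDiff_pd m hh)), Finset.mul_sum]
    refine Finset.sum_congr rfl fun m _ => ?_
    rw [pd_mul l (hb m) (contDiff_pd m hh)]; ring
  rw [hexp ha hb, hexp hb ha]
  -- the second-order terms cancel by symmetry
  have hsymm : ∑ l, ∑ m, b l y * a m y * pd e l (pd e m h) y = ∑ l, ∑ m, a l y * b m y * pd e l (pd e m h) y := by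
    rw [Finset.sum_comm]
    refine Finset.sum_congr rfl fun l _ => Finset.sum_congr rfl fun m _ => ?_
    rw [pd_pd_comm m l hh]; ring
  simp only [Finset.sum_add_distrib]
  rw [hsymm]
  -- what is left is `∑_m [X,Y]_m ∂_m h`
  simp only [XdC, brC, sub_mul, Finset.sum_mul, Finset.sum_sub_distrib]
  rw [Finset.sum_comm (f := fun l m => a l y * pd e l (b m) y * pd e m h y),
    Finset.sum_comm (f := fun l m => b l y * pd e l (a m) y * pd e m h y)]
  ring

/-- **The divergence of a bracket**: `div [X, Y] = X (div Y) - Y (div X)`. [folklore] -/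
theorem SmoothFam.divC_brC (ha : SmoothFam a) (hb : SmoothFam b) (y : V) :
    divC e (brC e a b) y = XdC e a (divC e b) y - XdC e b (divC e a) y := by
  have hexp : ∀ {a b : Fin n → V → ℂ}, SmoothFam a → SmoothFam b →
      (∑ m, pd e m (fun z => XdC e a (b m) z) y) =
        ∑ m, ∑ l, (pd e m (a l) y * pd e l (b m) y + a l y * pd e m (pd e l (b m)) y) := by
    intro a b ha hb
    refine Finset.sum_congr rfl fun m _ => ?_
    show pd e m (fun z => ∑ l ∈ Finset.univ, a l z * pd e l (b m) z) y = _
    rw [pd_sum m Finset.univ (fun l => (ha l).mul (contDiff_pd l (hb m)))]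
    refine Finset.sum_congr rfl fun l _ => ?_
    rw [pd_mul m (ha l) (contDiff_pd l (hb m))]; ring
  have hsub : divC e (brC e a b) y = (∑ m, pd e m (fun z => XdC e a (b m) z) y) -
      ∑ m, pd e m (fun z => XdC e b (a m) z) y := by
    simp only [divC, ← Finset.sum_sub_distrib]
    refine Finset.sum_congr rfl fun m _ => ?_
    exact pd_sub m (ha.contDiff_XdC (hb m)) (hb.contDiff_XdC (ha m)) y
  rw [hsub, hexp ha hb, hexp hb ha]
  -- first-order cross terms cancel, second-order terms are `X (div Y)`, `Y (div X)`
  have hX : ∀ {a b : Fin n → V → ℂ}, SmoothFam a → SmoothFam b →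
      XdC e a (divC e b) y = ∑ m, ∑ l, a l y * pd e m (pd e l (b m)) y := by
    intro a b _ hb
    simp only [XdC]
    rw [Finset.sum_comm]
    refine Finset.sum_congr rfl fun l _ => ?_
    show a l y * pd e l (fun y => ∑ m ∈ Finset.univ, pd e m (b m) y) y = _
    rw [pd_sum l Finset.univ (fun m => contDiff_pd m (hb m)), Finset.mul_sum]
    refine Finset.sum_congr rfl fun m _ => ?_
    rw [pd_pd_comm l m (hb m)]
  rw [hX ha hb, hX hb ha]
  have hcross : ∑ m, ∑ l, pd e m (b l) y * pd e l (a m) y = ∑ m, ∑ l, pd e m (a l) y * pd e l (b m) y := by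
    rw [Finset.sum_comm]
    refine Finset.sum_congr rfl fun l _ => Finset.sum_congr rfl fun m _ => ?_
    ring
  simp only [Finset.sum_add_distrib]
  rw [hcross]
  ring

/-- **`[X♭, Y♭] = [X, Y]♭`.** [folklore] -/
theorem SmoothFam.flatC_comm (ha : SmoothFam a) (hb : SmoothFam b) (hh : ContDiff ℝ ∞ h) (y : V) :
    flatC e a (flatC e b h) y - flatC e b (flatC e a h) y = flatC e (brC e a b) h y := by
  -- `X♭ (Y♭ h) = X (Y h) + (X dY) h + dY X h + dX Y h + dX dY h`
  have hexp : ∀ {a b : Fin n → V → ℂ}, SmoothFam a → SmoothFam b →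
      flatC e a (flatC e b h) y = XdC e a (XdC e b h) y + XdC e a (divC e b) y * h y +
        divC e b y * XdC e a h y + divC e a y * XdC e b h y + divC e a y * divC e b y * h y := by
    intro a b ha hb
    have hfb : flatC e b h = fun z => XdC e b h z + divC e b z * h z := funext fun z => hb.flatC_eq hh z
    rw [ha.flatC_eq (hb.contDiff_flatC hh), hfb,
      XdC_add (hb.contDiff_XdC hh) (hb.contDiff_divC.mul hh), XdC_mul hb.contDiff_divC hh]
    ring
  rw [hexp ha hb, hexp hb ha, (ha.bracket hb).flatC_eq hh, ← ha.comm_XdC hb hh, ha.divC_brC hb]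
  ring

/-- Rescaling the coefficients: `(β X)♭ h = X♭ (β h)`. [folklore] -/
theorem flatC_mul_fam (β : V → ℂ) (a : Fin n → V → ℂ) (h : V → ℂ) :
    flatC e (fun l z => β z * a l z) h = flatC e a (fun z => β z * h z) := by
  ext y
  simp only [flatC]
  refine Finset.sum_congr rfl fun l _ => ?_
  congr 1
  ext z; ring

/-- Additivity in the coefficients. [folklore] -/
theorem flatC_add_fam (ha : SmoothFam a) (hb : SmoothFam b) (hh : ContDiff ℝ ∞ h) (y : V) :
    flatC e (fun l z => a l z + b l z) h y = flatC e a h y + flatC e b h y := by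
  simp only [flatC, ← Finset.sum_add_distrib]
  refine Finset.sum_congr rfl fun l _ => ?_
  rw [← pd_add l ((ha l).mul hh) ((hb l).mul hh)]
  congr 1; ext z; ring

/-- Finite sums in the coefficients. [folklore] -/
theorem flatC_sum_fam {ι : Type*} (S : Finset ι) {A : ι → Fin n → V → ℂ} (hA : ∀ i, SmoothFam (A i))
    (hh : ContDiff ℝ ∞ h) (y : V) :
    flatC e (fun l z => ∑ i ∈ S, A i l z) h y = ∑ i ∈ S, flatC e (A i) h y := by
  classical
  induction S using Finset.induction_on with
  | empty =>
    simp only [Finset.sum_empty, flatC, zero_mul]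
    simp [pd]
  | insert j S hj ih =>
    simp only [Finset.sum_insert hj]
    rw [← ih, ← flatC_add_fam (hA j) (fun l => ContDiff.sum fun i _ => hA i l) hh]

/-- Constants in `h`. [folklore] -/
theorem flatC_const_mul (ha : SmoothFam a) (c : ℂ) (hh : ContDiff ℝ ∞ h) (y : V) :
    flatC e a (fun z => c * h z) y = c * flatC e a h y := by
  simp only [flatC, Finset.mul_sum]
  refine Finset.sum_congr rfl fun l _ => ?_
  rw [← pd_const_mul l c ((ha l).mul hh)]
  congr 1; ext z; ring

/-- The flat operator of the `k`-th frame field `∂_{e_k}` is `∂_{e_k}`. [folklore] -/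
theorem flatC_single (k : Fin n) (h : V → ℂ) (y : V) :
    flatC e (fun l _ => if l = k then 1 else 0) h y = pd e k h y := by
  simp only [flatC]
  rw [Finset.sum_eq_single k]
  · simp
  · intro l _ hl
    simp only [if_neg hl, zero_mul]
    simp [pd]
  · intro hk; exact absurd (Finset.mem_univ k) hk

end FieldCalculus

/-! ### Coefficient families and their Fourier-side encoding -/

variable [FiniteDimensional ℝ V] [MeasurableSpace V] [BorelSpace V]

variable (V) in
/-- **Coefficient families** `c_l + a_l`: real constants plus real Schwartz functions. [folklore] -/
structure CoefFam (n : ℕ) where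
  /-- the constant parts [folklore] -/
  c : Fin n → ℝ
  /-- the Schwartz parts [folklore] -/
  a : Fin n → 𝓢(V, ℂ)
  real : ∀ l y, conj (a l y) = a l y

namespace CoefFam

variable (F : CoefFam V n)

/-- The coefficient functions `c_l + a_l`. [folklore] -/
def fn : Fin n → V → ℂ := fun l y => (F.c l : ℂ) + F.a l y

omit [FiniteDimensional ℝ V] [MeasurableSpace V] [BorelSpace V] in
/-- The coefficients are smooth. [folklore] -/
theorem smooth : SmoothFam F.fn := fun l => contDiff_const.add ((F.a l).smooth ⊤)

/-- The coefficient expression of the `l`-th coefficient: `cmul c_l + conv θ_{a_l}`. [folklore] -/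
def coefSym (l : Fin n) : Sym V := Sym.add (Sym.cmul (F.c l)) (Sym.conv (thetaOf (F.a l)))

/-- **The Fourier-side encoding** of the field `∑_l (c_l + a_l) ∂_{e_l}`. [folklore] -/
def enc (e : Fin n → V) : Field V := List.ofFn fun l => (F.coefSym l, e l)

/-- The coefficient expressions are good. [folklore] -/
theorem good_coefSym (l : Fin n) : Sym.Good (F.coefSym l) :=
  (Sym.Good.cmul _).add (Sym.Good.conv _)

/-- The coefficient expressions are coefficient expressions. [folklore] -/
theorem isCoef_coefSym (l : Fin n) : Sym.IsCoef (F.coefSym l) := ⟨trivial, trivial⟩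

/-- The coefficient expressions are real. [folklore] -/
theorem realCoef_coefSym (l : Fin n) : Sym.RealCoef (F.coefSym l) :=
  ⟨Complex.ofReal_im _, reflConj_thetaOf (F.real l)⟩

/-- The encoding is a field. [folklore] -/
theorem isField_enc : Field.IsField (F.enc e) := by
  intro p hp
  obtain ⟨l, rfl⟩ := List.mem_ofFn.1 hp
  exact F.isCoef_coefSym l

/-- The encoding is certified. [folklore] -/
theorem certF_enc : Field.CertF (F.enc e) := by
  intro p hp
  obtain ⟨l, rfl⟩ := List.mem_ofFn.1 hp
  exact (F.good_coefSym l).cert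

/-- The encoding is real. [folklore] -/
theorem isReal_enc : Field.IsReal (F.enc e) := by
  intro p hp
  obtain ⟨l, rfl⟩ := List.mem_ofFn.1 hp
  exact F.realCoef_coefSym l

/-- The encoding is nonempty when `n ≠ 0`. [folklore] -/
theorem enc_ne_nil (hn : n ≠ 0) : F.enc e ≠ [] := by
  unfold enc
  rw [Ne, List.ofFn_eq_nil_iff]
  exact hn

/-- `dx` of a coefficient expression is multiplication by the coefficient. [folklore] -/
theorem dx_coefSym (l : Fin n) (g : V → ℂ) : Sym.dx (F.coefSym l) g = fun y => F.fn l y * g y := by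
  ext y
  simp only [coefSym, Sym.dx_add, Sym.dx_cmul, Sym.dx_conv_thetaOf, fn, Complex.conj_ofReal]
  ring

end CoefFam

namespace Sym

/-- Good expressions are closed under `Sym.sum`. [folklore] -/
theorem Good.sum : ∀ {l : List (Sym V)}, (∀ s ∈ l, Good s) → Good (Sym.sum l)
  | [], _ => Good.cmul 0
  | [s], h => h s (List.mem_singleton_self s)
  | s :: t :: l, h => by
    rw [sum_cons_cons]
    exact (h s List.mem_cons_self).add (Good.sum fun u hu => h u (List.mem_cons_of_mem _ hu))

/-- `dx` of a sum. [folklore] -/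
theorem dx_sum :
    ∀ (l : List (Sym V)) (g : V → ℂ), dx (Sym.sum l) g = fun y => (l.map fun s => dx s g y).sum
  | [], g => by ext y; simp [Sym.sum, Sym.zero]
  | [s], g => by ext y; simp [Sym.sum]
  | s :: t :: l, g => by
    ext y
    rw [sum_cons_cons, dx_add]
    simp only [dx_sum (t :: l) g, List.map_cons, List.sum_cons]

/-- `dx` of a commutator. [folklore] -/
theorem dx_comm (s t : Sym V) (g : V → ℂ) :
    dx (comm s t) g = fun y => dx t (dx s g) y - dx s (dx t g) y := by
  ext y
  simp [comm, Sym.sub, Sym.neg, dx]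
  ring

/-- Good expressions are closed under commutators. [folklore] -/
theorem Good.comm {s t : Sym V} (hs : Good s) (ht : Good t) : Good (comm s t) :=
  (hs.comp ht).add ((ht.comp hs).smul _)

/-- `dx` of a good expression preserves smoothness. [folklore] -/
theorem Good.contDiff_dx {s : Sym V} (hs : Good s) : ∀ {g : V → ℂ}, ContDiff ℝ ∞ g → ContDiff ℝ ∞ (dx s g) := by
  induction hs with
  | lin v => intro g hg; exact (hg.fderiv_right (m := ∞) (mod_cast le_top)).clm_apply contDiff_const
  | cmul c => intro g hg; exact contDiff_const.mul hg
  | conv b => intro g hg; rw [dx_conv_thetaOf]; exact (b.smooth ⊤).mul hg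
  | smul c _ ih => intro g hg; exact contDiff_const.mul (ih hg)
  | add _ _ ih ih' => intro g hg; exact (ih hg).add (ih' hg)
  | comp _ _ ih ih' => intro g hg; exact ih' (ih hg)

/-- `dx` of a good expression is homogeneous on smooth functions. [folklore] -/
theorem Good.dx_const_mul {s : Sym V} (hs : Good s) (c : ℂ) :
    ∀ {g : V → ℂ}, ContDiff ℝ ∞ g → dx s (fun y => c * g y) = fun y => c * dx s g y := by
  induction hs with
  | lin v =>
    intro g hg; ext y
    simp only [dx_lin]
    rw [fderiv_const_mul (hg.differentiable (by simp)).differentiableAt]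
    simp
  | cmul c' => intro g hg; ext y; simp only [dx_cmul]; ring
  | conv b => intro g hg; ext y; simp only [dx_conv_thetaOf]; ring
  | smul c' _ ih => intro g hg; ext y; simp only [dx_smul]; rw [ih hg]; ring
  | add _ _ ih ih' => intro g hg; ext y; simp only [dx_add]; rw [ih hg, ih' hg]; ring
  | comp hs _ ih ih' => intro g hg; simp only [dx_comp]; rw [ih hg, ih' (hs.contDiff_dx hg)]

/-- `dx` of a good expression is additive on smooth functions. [folklore] -/
theorem Good.dx_map_add {s : Sym V} (hs : Good s) :
    ∀ {f g : V → ℂ}, ContDiff ℝ ∞ f → ContDiff ℝ ∞ g →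
      dx s (fun y => f y + g y) = fun y => dx s f y + dx s g y := by
  induction hs with
  | lin v =>
    intro f g hf hg; ext y
    simp only [dx_lin]
    rw [fderiv_fun_add (hf.differentiable (by simp)).differentiableAt (hg.differentiable (by simp)).differentiableAt]
    rfl
  | cmul c' => intro f g hf hg; ext y; simp only [dx_cmul]; ring
  | conv b => intro f g hf hg; ext y; simp only [dx_conv_thetaOf]; ring
  | smul c' _ ih => intro f g hf hg; ext y; simp only [dx_smul]; rw [ih hf hg]; ring
  | add _ _ ih ih' => intro f g hf hg; ext y; simp only [dx_add]; rw [ih hf hg, ih' hf hg]; ring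
  | comp hs _ ih ih' =>
    intro f g hf hg; simp only [dx_comp]; rw [ih hf hg, ih' (hs.contDiff_dx hf) (hs.contDiff_dx hg)]

end Sym

/-! ### `dx (toSym enc) = ♭` -/

namespace CoefFam

variable (F : CoefFam V n)

/-- The symbolic operator of the encoding is good. [folklore] -/
theorem good_toSym_enc : Sym.Good (Field.toSym (F.enc e)) := by
  unfold Field.toSym
  refine Sym.Good.sum fun s hs => ?_
  obtain ⟨p, hp, rfl⟩ := List.mem_map.1 hs
  obtain ⟨l, rfl⟩ := List.mem_ofFn.1 hp
  exact (F.good_coefSym l).comp (Sym.Good.lin _)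

/-- **`dx (toSym enc) h = ♭ h`.** [folklore] -/
theorem dx_toSym_enc (h : V → ℂ) : Sym.dx (Field.toSym (F.enc e)) h = flatC e F.fn h := by
  unfold Field.toSym enc
  rw [Sym.dx_sum]
  ext y
  rw [List.map_ofFn, List.map_ofFn, List.sum_ofFn]
  simp only [flatC, Function.comp_def, Sym.dx_comp, Sym.dx_lin, dx_coefSym]
  rfl

end CoefFam

/-! ### Bracket words on both sides -/

section Words

variable {J : ℕ} (fams : Fin J → CoefFam V n) (fam0 : CoefFam V n)

/-- The `x`-side iterated bracket of a word (coordinates in the frame). [folklore] -/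
def Fw : BWord J → Fin n → V → ℂ
  | BWord.base j => (fams j).fn
  | BWord.base0 => fam0.fn
  | BWord.consJ j w => brC e (fams j).fn (Fw w)
  | BWord.cons0 w => brC e fam0.fn (Fw w)

/-- The symbolic iterated commutator of a word. [folklore] -/
def Cw : BWord J → Sym V
  | BWord.base j => Field.toSym ((fams j).enc e)
  | BWord.base0 => Field.toSym (fam0.enc e)
  | BWord.consJ j w => Sym.comm (Field.toSym ((fams j).enc e)) (Cw w)
  | BWord.cons0 w => Sym.comm (Field.toSym (fam0.enc e)) (Cw w)

/-- The sign of a word: `dx` reverses compositions, so each bracket flips a sign. [folklore] -/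
def sgn : BWord J → ℂ
  | BWord.base _ => 1
  | BWord.base0 => 1
  | BWord.consJ _ w => -sgn w
  | BWord.cons0 w => -sgn w

/-- `sgn w * conj (sgn w) = 1` (the signs are `±1`). [folklore] -/
theorem sgn_mul_conj : ∀ w : BWord J, sgn w * conj (sgn w) = 1
  | BWord.base _ => by simp [sgn]
  | BWord.base0 => by simp [sgn]
  | BWord.consJ _ w => by simp only [sgn, map_neg, neg_mul_neg]; exact sgn_mul_conj w
  | BWord.cons0 w => by simp only [sgn, map_neg, neg_mul_neg]; exact sgn_mul_conj w

variable {fams fam0}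

omit [FiniteDimensional ℝ V] [MeasurableSpace V] [BorelSpace V] in
/-- The `x`-side brackets are smooth. [folklore] -/
theorem smoothFam_Fw : ∀ w : BWord J, SmoothFam (Fw (e := e) fams fam0 w)
  | BWord.base j => (fams j).smooth
  | BWord.base0 => fam0.smooth
  | BWord.consJ j w => (fams j).smooth.bracket (smoothFam_Fw w)
  | BWord.cons0 w => fam0.smooth.bracket (smoothFam_Fw w)

/-- The symbolic commutators are good. [folklore] -/
theorem good_Cw : ∀ w : BWord J, Sym.Good (Cw (e := e) fams fam0 w)
  | BWord.base j => (fams j).good_toSym_enc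
  | BWord.base0 => fam0.good_toSym_enc
  | BWord.consJ j w => (fams j).good_toSym_enc.comm (good_Cw w)
  | BWord.cons0 w => fam0.good_toSym_enc.comm (good_Cw w)

/-- The bracket step of `dx_Cw`. [folklore] -/
theorem dx_comm_toSym_enc (F : CoefFam V n) {s : Sym V} {b : Fin n → V → ℂ}
    (hb : SmoothFam b) {c : ℂ}
    (ih : ∀ {g : V → ℂ}, ContDiff ℝ ∞ g → Sym.dx s g = fun y => c * flatC e b g y)
    {h : V → ℂ} (hh : ContDiff ℝ ∞ h) :
    Sym.dx (Sym.comm (Field.toSym (F.enc e)) s) h = fun y => (-c) * flatC e (brC e F.fn b) h y := by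
  rw [Sym.dx_comm]
  ext y
  rw [F.dx_toSym_enc, ih (F.smooth.contDiff_flatC hh), ih hh,
    F.good_toSym_enc.dx_const_mul c (hb.contDiff_flatC hh), F.dx_toSym_enc]
  simp only
  rw [← F.smooth.flatC_comm hb hh y]
  ring

/-- **`dx (Cw w) h = sgn w · (Fw w)♭ h`** for smooth `h`. [folklore] -/
theorem dx_Cw : ∀ (w : BWord J) {h : V → ℂ}, ContDiff ℝ ∞ h →
    Sym.dx (Cw (e := e) fams fam0 w) h = fun y => sgn w * flatC e (Fw (e := e) fams fam0 w) h y
  | BWord.base j, h, _ => by rw [Cw, (fams j).dx_toSym_enc]; ext y; simp [sgn, Fw]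
  | BWord.base0, h, _ => by rw [Cw, fam0.dx_toSym_enc]; ext y; simp [sgn, Fw]
  | BWord.consJ j w, h, hh => by
    rw [Cw, sgn, Fw]
    exact dx_comm_toSym_enc (fams j) (smoothFam_Fw w) (fun hg => dx_Cw w hg) hh
  | BWord.cons0 w, h, hh => by
    rw [Cw, sgn, Fw]
    exact dx_comm_toSym_enc fam0 (smoothFam_Fw w) (fun hg => dx_Cw w hg) hh

end Words

end Literature.Analysis.Hypoelliptic
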